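import Literature.Geometry.Lorentzian.CoordGlobalWeightedGarding
import Mathlib.Analysis.Complex.Exponential
import HarnessLib

/-!
# The global weighted Gårding inequality with an `L²` lower-order term

Topic `Literature/Geometry/Lorentzian`, coordinate tensor calculus `MetricCoord`. Everything here is
PROVED; no definition and no statement of `Prop` type is introduced.

`IsMetricOn.globalWeightedGarding` (`CoordGlobalWeightedGarding.lean`) controls the weighted
`H̊¹ × H̊²` norm of a compactly supported pair `(Y, N)` by `‖ΦP*(Y,N)‖_{L²_ψ}` plus the unweighted
lower-order term `∫ √g (N² + |Y|² + |∇N|²)`. The gradient term is removed here by the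
interpolation `∫|∇N|² ≤ (λ/2)∫N² + (1/2λ)∫(ΔN)²`, `(ΔN)² ≤ n|Hess N|²` and the lower bound
`(2σ)⁸/8! ≤ e^{2σ/x}x⁸` of the weight, absorbing the Hessian into the left-hand side:

* `IsMetricOn.integral_gradSq_le_param` — `∫ √g|∇N|² ≤ (λ/2)∫ √g N² + (2λ)⁻¹∫ √g (ΔN)²`, `λ > 0`;
* `exp_weight_pow_eight_ge` — `(2σ)⁸/8! ≤ e^{2σ/r} r⁸` for `r > 0`, `σ ≥ 0`;
* **`IsMetricOn.globalWeightedGardingL2`** — the conclusion of `globalWeightedGarding` with the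
  lower-order term `∫ √g (N² + |Y|²)` only:
  `‖Y‖²_{H̊¹_{φ,ψ}} + ‖N‖²_{H̊²_{φ,ψ}} ≤ A (‖ΦP*(Y,N)‖²_{L²_ψ} + ‖N‖²_{L²} + ‖Y‖²_{L²})`,
  the form of Chruściel–Delay's Prop. 3.3 / Remark 3.2 in which the compact perturbation is the
  `L²` norm (removed by Rellich compactness when `P*` has no kernel).

## References

* P. T. Chruściel, E. Delay, Mém. Soc. Math. Fr. 94 (2003), §3, Prop. 3.1/3.3 and Remark 3.2.
  [ChruscielDelay2003]
-/

noncomputable section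

set_option maxSynthPendingDepth 3

open Set Filter Module Function MeasureTheory
open scoped Topology ContDiff Nat

namespace Literature.Geometry.Lorentzian

namespace MetricCoord

variable {E : Type*} [NormedAddCommGroup E] [NormedSpace ℝ E] [FiniteDimensional ℝ E]
  [CompleteSpace E] {ι : Type*} [Fintype ι] [DecidableEq ι] (b : Basis ι ℝ E)
  {G : E → E →L[ℝ] E →L[ℝ] ℝ} {V : Set E} {K : E → E →L[ℝ] E →L[ℝ] ℝ} {xf : E → ℝ} {N : E → ℝ}
  [MeasurableSpace E] [BorelSpace E] (μ : Measure E) [μ.IsAddHaarMeasure]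

/-! ### Interpolation with a parameter -/

/-- **`∫ √g|∇N|² ≤ (λ/2) ∫ √g N² + (2λ)⁻¹ ∫ √g (ΔN)²`** for `N` smooth on `V` with compact support
inside `V` and `λ > 0` (`div(N∇N) = |∇N|² + NΔN`, the divergence theorem, and
`−NΔN ≤ (λ/2)N² + (2λ)⁻¹(ΔN)²`). [folklore] -/
theorem IsMetricOn.integral_gradSq_le_param (hG : IsMetricOn G V)
    (hpos : ∀ y ∈ V, ∀ e : E, e ≠ 0 → 0 < G y e e)
    (hN : ContDiffOn ℝ ∞ N V) (hNs : HasCompactSupport N) (hNV : tsupport N ⊆ V)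
    {lam : ℝ} (hlam : 0 < lam) :
    ∫ y, sqrtDetGram G b y * gradSqAt G N y ∂μ ≤
      lam / 2 * ∫ y, sqrtDetGram G b y * N y ^ 2 ∂μ
        + (2 * lam)⁻¹ * ∫ y, sqrtDetGram G b y * lapAt G N y ^ 2 ∂μ := by
  -- the field `B = N ∇N`
  set B : E → E := fun y ↦ N y • sharpAt G y (fderiv ℝ N y) with hBdef
  have hN0 : ∀ y ∉ tsupport N, N y = 0 ∧ fderiv ℝ N y = 0 := fun y hy ↦
    (eventually_eq_zero_and_fderiv_eq_zero hy).self_of_nhds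
  have hZs : ContDiffOn ℝ ∞ (fun y ↦ sharpAt G y (fderiv ℝ N y)) V :=
    hG.contDiffOn_sharpAt.clm_apply (hN.fderiv_of_isOpen hG.isOpen (by simp))
  have hBs : ContDiffOn ℝ ∞ B V := hN.smul hZs
  have hB0 : ∀ y ∉ tsupport N, B y = 0 := fun y hy ↦ by simp [hBdef, (hN0 y hy).1]
  have hBt : tsupport B ⊆ tsupport N :=
    closure_minimal (fun y hy ↦ by by_contra h; exact hy (hB0 y h)) (isClosed_tsupport N)
  have hBsupp : HasCompactSupport B := hNs.mono' ((subset_tsupport _).trans hBt)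
  have hBV : tsupport B ⊆ V := hBt.trans hNV
  have hdiv0 : ∫ y, sqrtDetGram G b y * divAt G B y ∂μ = 0 :=
    hG.integral_sqrtDetGram_mul_divAt_eq_zero b μ hpos hBs hBsupp hBV
  -- `div B = |∇N|² + N ΔN` on `V`
  have hdiv : ∀ y ∈ V, divAt G B y = gradSqAt G N y + N y * lapAt G N y := by
    intro y hy
    have hys := hG.mem_nhds hy
    have hNd : DifferentiableAt ℝ N y := ((hN y hy).contDiffAt hys).differentiableAt (by simp)
    have hZd : DifferentiableAt ℝ (fun z ↦ sharpAt G z (fderiv ℝ N z)) y :=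
      ((hZs y hy).contDiffAt hys).differentiableAt (by simp)
    rw [hBdef, divAt_smul hNd hZd, hG.divAt_sharpAt_fderiv hy hN, gradSqAt_apply]
    ring
  -- integrability
  have hdivB0 : ∀ y ∉ tsupport N, divAt G B y = 0 := fun y hy ↦
    divAt_eq_zero_of_eventuallyEq_zero (notMem_tsupport_iff_eventuallyEq.mp fun h ↦ hy (hBt h))
  have hlap0 : ∀ y ∉ tsupport N, lapAt G N y = 0 := fun y hy ↦ by
    rw [lapAt_congr_of_eventuallyEq G (notMem_tsupport_iff_eventuallyEq.mp hy)]
    exact lapAt_const G 0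
  have hg0 : ∀ y ∉ tsupport N, gradSqAt G N y = 0 := fun y hy ↦ by
    rw [gradSqAt_apply, (hN0 y hy).2]; rfl
  have hInt : ∀ {k : E → ℝ}, ContDiffOn ℝ ∞ k V → (∀ z ∉ tsupport N, k z = 0) →
      Integrable (fun z ↦ sqrtDetGram G b z * k z) μ := fun hk hk0 ↦
    hG.integrable_sqrtDetGram_mul_of_subset b μ hpos hNs (isClosed_tsupport N) hNV hk hk0
  have hI₁ := hInt (hG.contDiffOn_gradSqAt hN) hg0
  have hI₂ := hInt (hN.pow 2) fun z hz ↦ by simp [(hN0 z hz).1]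
  have hI₃ := hInt ((hG.contDiffOn_lapAt hN).pow 2) fun z hz ↦ by simp [hlap0 z hz]
  have hId := hInt (hG.contDiffOn_divAt hBs) hdivB0
  -- `|∇N|² = div B − NΔN ≤ div B + (λ/2)N² + (2λ)⁻¹(ΔN)²`
  have h := integral_sqrtDetGram_le_of_pointwise₃ b μ (tsupport N) (lam / 2) (2 * lam)⁻¹ 1 hI₁
    hI₂ hI₃ hId (fun y hy ↦ ?_)
    (fun y hy ↦ ⟨hg0 y hy, by simp [(hN0 y hy).1], by simp [hlap0 y hy], hdivB0 y hy⟩)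
  · rw [hdiv0, mul_zero, add_zero] at h
    exact h
  · rw [hdiv y (hNV hy)]
    -- Young: `-N ΔN ≤ (λ/2) N² + (2λ)⁻¹ (ΔN)²` from `0 ≤ (λ N + ΔN)² / λ`
    have key : 0 ≤ lam / 2 * N y ^ 2 + (2 * lam)⁻¹ * lapAt G N y ^ 2 + N y * lapAt G N y := by
      have hsq := sq_nonneg (lam * N y + lapAt G N y)
      have e : lam / 2 * N y ^ 2 + (2 * lam)⁻¹ * lapAt G N y ^ 2 + N y * lapAt G N y
          = (lam * N y + lapAt G N y) ^ 2 / (2 * lam) := by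
        field_simp
        ring
      rw [e]
      positivity
    linarith

/-! ### The weight is bounded below -/

omit [MeasurableSpace E] [BorelSpace E] in
/-- `(2σ)⁸/8! ≤ e^{2σ/r} r⁸` for `r > 0`, `σ ≥ 0` (`t⁸/8! ≤ eᵗ` with `t = 2σ/r`). [folklore] -/
theorem exp_weight_pow_eight_ge {σ r : ℝ} (hσ : 0 ≤ σ) (hr : 0 < r) :
    (2 * σ) ^ 8 / (8 ! : ℕ) ≤ Real.exp (2 * σ / r) * r ^ 8 := by
  have ht : 0 ≤ 2 * σ / r := by positivity
  have h := Real.pow_div_factorial_le_exp (2 * σ / r) ht 8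
  have hr8 : 0 < r ^ 8 := by positivity
  have hr0 : r ≠ 0 := hr.ne'
  have e : (2 * σ) ^ 8 / (8 ! : ℕ) = (2 * σ / r) ^ 8 / (8 ! : ℕ) * r ^ 8 := by
    rw [div_pow]
    field_simp
  rw [e]
  exact mul_le_mul_of_nonneg_right h hr8.le

/-! ### The Gårding inequality with an `L²` lower-order term -/

set_option maxHeartbeats 800000 in
/-- **The global weighted Gårding inequality, `L²` lower-order term** (Chruściel–Delay 2003,
Prop. 3.3 / Remark 3.2, deterministic half). Under the hypotheses of
`IsMetricOn.globalWeightedGarding` (Riemannian `G` on `V`, `dim ≠ 1`; smooth symmetric `K`;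
`x` smooth on `V` with a compact collar `{0 < x < x₁} ⊆ C₁ ⊆ V` on which `∇x ≠ 0`; the domain
`M = {y ∈ V | 0 < x}` inside a compact `C ⊆ V`): for every `σ > 0` there is `A` such that for all
`N, Y` smooth on `V` with compact support in `M`,
`∫ √g e^{2σ/x}(|Y|² + x⁴Q(∇Y)) + ∫ √g e^{2σ/x}(N² + x⁴|∇N|² + x⁸|Hess N|²)`
`  ≤ A (∫ √g e^{2σ/x}x⁴|R_K|² + ∫ √g e^{2σ/x}x⁸|R_G|² + ∫ √g N² + ∫ √g |Y|²)`.
[cite: ChruscielDelay2003, Prop. 3.3 (proof), Remark 3.2] -/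
theorem IsMetricOn.globalWeightedGardingL2 (hG : IsMetricOn G V)
    (hpos : ∀ y ∈ V, ∀ e : E, e ≠ 0 → 0 < G y e e) (hn : finrank ℝ E ≠ 1)
    (hK : ContDiffOn ℝ ∞ K V) (hKs : ∀ y ∈ V, ∀ v w, K y v w = K y w v)
    (hxf : ContDiffOn ℝ ∞ xf V) {x₁ : ℝ} (hx₁ : 0 < x₁) {C₁ : Set E} (hC₁ : IsCompact C₁)
    (hC₁V : C₁ ⊆ V) (hcol : {y ∈ V | 0 < xf y ∧ xf y < x₁} ⊆ C₁)
    (hdx : ∀ y ∈ C₁, gradSqAt G xf y ≠ 0)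
    {C : Set E} (hC : IsCompact C) (hCV : C ⊆ V) (hMC : {y ∈ V | 0 < xf y} ⊆ C)
    {σ : ℝ} (hσ : 0 < σ) :
    ∃ A : ℝ, ∀ (N : E → ℝ) (Y : E → E), ContDiffOn ℝ ∞ N V → ContDiffOn ℝ ∞ Y V →
      HasCompactSupport N → HasCompactSupport Y →
      tsupport N ⊆ {y ∈ V | 0 < xf y} → tsupport Y ⊆ {y ∈ V | 0 < xf y} →
      ∫ y, sqrtDetGram G b y * (Real.exp (2 * σ / xf y) * G y (Y y) (Y y)) ∂μ
        + ∫ y, sqrtDetGram G b y * (Real.exp (2 * σ / xf y) * xf y ^ 4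
            * mtrAt G y ((G y).bilinearComp (covDAt G Y y) (covDAt G Y y))) ∂μ
        + ∫ y, sqrtDetGram G b y * (Real.exp (2 * σ / xf y) * N y ^ 2) ∂μ
        + ∫ y, sqrtDetGram G b y * (Real.exp (2 * σ / xf y) * xf y ^ 4 * gradSqAt G N y) ∂μ
        + ∫ y, sqrtDetGram G b y * (Real.exp (2 * σ / xf y) * xf y ^ 8
            * normSqAt G y (hessAt G N y)) ∂μ ≤
      A * (∫ y, sqrtDetGram G b y * (Real.exp (2 * σ / xf y) * xf y ^ 4
              * normSqAt G y (adjHamK G K N y + adjMomKS G Y y)) ∂μ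
          + ∫ y, sqrtDetGram G b y * (Real.exp (2 * σ / xf y) * xf y ^ 8
              * normSqAt G y (adjHamG G K N y + adjMomGS G K Y y)) ∂μ
          + ∫ y, sqrtDetGram G b y * N y ^ 2 ∂μ
          + ∫ y, sqrtDetGram G b y * G y (Y y) (Y y) ∂μ) := by
  obtain ⟨A, hA⟩ := hG.globalWeightedGarding b μ hpos hn hK hKs hxf hx₁ hC₁ hC₁V hcol hdx hC hCV
    hMC hσ
  -- constants
  set A' : ℝ := max A 0 with hA'
  have hA'0 : 0 ≤ A' := le_max_right _ _
  have hn0 : 0 ≤ (finrank ℝ E : ℝ) := Nat.cast_nonneg _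
  obtain ⟨c₈, hc₈⟩ : ∃ c : ℝ, c = (2 * σ) ^ 8 / (8 ! : ℕ) := ⟨_, rfl⟩
  have hc₈0 : 0 < c₈ := by rw [hc₈]; positivity
  -- `(ΔN)² ≤ n |Hess N|² ≤ (n/c₈) e^{2σ/x}x⁸|Hess N|²`; choose `λ` with `A' (2λ)⁻¹ (n/c₈) ≤ 1/4`
  obtain ⟨lam, hlam⟩ : ∃ l : ℝ, l = 2 * A' * ((finrank ℝ E : ℝ) / c₈) + 1 := ⟨_, rfl⟩
  have hlam0 : 0 < lam := by rw [hlam]; positivity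
  have hkey : A' * ((2 * lam)⁻¹ * ((finrank ℝ E : ℝ) / c₈)) ≤ 4⁻¹ := by
    rw [show A' * ((2 * lam)⁻¹ * ((finrank ℝ E : ℝ) / c₈))
      = (A' * ((finrank ℝ E : ℝ) / c₈)) / (2 * lam) by ring]
    rw [div_le_iff₀ (by positivity), hlam]
    linarith [mul_nonneg hA'0 (div_nonneg hn0 hc₈0.le)]
  refine ⟨4 * A' * (1 + lam), fun N Y hN hY hNs hYs hNS hYS ↦ ?_⟩
  have hNV : tsupport N ⊆ V := fun y hy ↦ (hNS hy).1
  have h1 := hA N Y hN hY hNs hYs hNS hYS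
  have h2 := hG.integral_gradSq_le_param b μ hpos hN hNs hNV hlam0
  -- notation
  set Wl := ∫ y, sqrtDetGram G b y * (Real.exp (2 * σ / xf y) * G y (Y y) (Y y)) ∂μ
    + ∫ y, sqrtDetGram G b y * (Real.exp (2 * σ / xf y) * xf y ^ 4
        * mtrAt G y ((G y).bilinearComp (covDAt G Y y) (covDAt G Y y))) ∂μ
    + ∫ y, sqrtDetGram G b y * (Real.exp (2 * σ / xf y) * N y ^ 2) ∂μ
    + ∫ y, sqrtDetGram G b y * (Real.exp (2 * σ / xf y) * xf y ^ 4 * gradSqAt G N y) ∂μ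
    with hWl
  set wH := ∫ y, sqrtDetGram G b y * (Real.exp (2 * σ / xf y) * xf y ^ 8
    * normSqAt G y (hessAt G N y)) ∂μ with hwH
  set R := ∫ y, sqrtDetGram G b y * (Real.exp (2 * σ / xf y) * xf y ^ 4
      * normSqAt G y (adjHamK G K N y + adjMomKS G Y y)) ∂μ
    + ∫ y, sqrtDetGram G b y * (Real.exp (2 * σ / xf y) * xf y ^ 8
      * normSqAt G y (adjHamG G K N y + adjMomGS G K Y y)) ∂μ with hR
  set Nn := ∫ y, sqrtDetGram G b y * N y ^ 2 ∂μ with hNn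
  set Yy := ∫ y, sqrtDetGram G b y * G y (Y y) (Y y) ∂μ with hYy
  set Dg := ∫ y, sqrtDetGram G b y * gradSqAt G N y ∂μ with hDg
  set L := ∫ y, sqrtDetGram G b y * lapAt G N y ^ 2 ∂μ with hL
  have i1 : Wl + wH ≤ A * (R + Nn + Yy + Dg) := h1
  have i2 : Dg ≤ lam / 2 * Nn + (2 * lam)⁻¹ * L := h2
  -- `L ≤ (n/c₈) wH`
  have hS : IsCompact (tsupport N) := hNs
  have hlap0 : ∀ y ∉ tsupport N, lapAt G N y = 0 := fun y hy ↦ by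
    rw [lapAt_congr_of_eventuallyEq G (notMem_tsupport_iff_eventuallyEq.mp hy)]
    exact lapAt_const G 0
  have hhess0 : ∀ y ∉ tsupport N, hessAt G N y = 0 := fun y hy ↦
    hessAt_eq_zero_of_eventuallyEq_const (notMem_tsupport_iff_eventuallyEq.mp hy)
  have hn00 : ∀ z, normSqAt G z (0 : E →L[ℝ] E →L[ℝ] ℝ) = 0 := fun z ↦ by
    simp [normSqAt_eq_traceCLM]
  have hInt : ∀ {k : E → ℝ}, ContDiffOn ℝ ∞ k V → (∀ z ∉ tsupport N, k z = 0) →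
      Integrable (fun z ↦ sqrtDetGram G b z * k z) μ := fun hk hk0 ↦
    hG.integrable_sqrtDetGram_mul_of_subset b μ hpos hNs (isClosed_tsupport N) hNV hk hk0
  have IL := hInt ((hG.contDiffOn_lapAt hN).pow 2) fun z hz ↦ by simp [hlap0 z hz]
  -- integrability of the weighted Hessian term: smooth on the collar `{0 < x < X}` containing the
  -- support
  obtain ⟨BX, hBX⟩ := hS.exists_bound_of_continuousOn ((hxf.continuousOn).mono hNV)
  set Mc : Set E := {y ∈ V | 0 < xf y ∧ xf y < BX + 1} with hMcdef
  have hSMc : tsupport N ⊆ Mc := fun y hy ↦ ⟨(hNS hy).1, (hNS hy).2,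
    ((le_abs_self _).trans (Real.norm_eq_abs (xf y) ▸ hBX y hy)).trans_lt (lt_add_one BX)⟩
  have hE : ContDiffOn ℝ ∞ (fun y ↦ Real.exp (2 * σ / xf y)) Mc := contDiffOn_expWeight_collar hxf σ _
  have hMcV : Mc ⊆ V := fun y hy ↦ hy.1
  have IH : Integrable (fun z ↦ sqrtDetGram G b z * (Real.exp (2 * σ / xf z) * xf z ^ 8
      * normSqAt G z (hessAt G N z))) μ :=
    hG.integrable_collar b μ hpos hxf hNs (isClosed_tsupport N) hSMc
      ((hE.mul ((hxf.mono hMcV).pow 8)).mul ((hG.contDiffOn_normSqAt (hG.contDiffOn_hessAt hN)).mono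
        hMcV)) fun z hz ↦ by rw [hhess0 z hz, hn00, mul_zero]
  have I0 : Integrable (fun z ↦ sqrtDetGram G b z * (fun _ ↦ (0 : ℝ)) z) μ := by simp
  have i3 : L ≤ ((finrank ℝ E : ℝ) / c₈) * wH + 0 * L + 0 * L := by
    rw [hL, hwH]
    refine integral_sqrtDetGram_le_of_pointwise₃ b μ (tsupport N) ((finrank ℝ E : ℝ) / c₈) 0 0
      IL IH IL IL (fun y hy ↦ ?_)
      (fun y hy ↦ ⟨by simp [hlap0 y hy], by rw [hhess0 y hy, hn00, mul_zero], by simp [hlap0 y hy],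
        by simp [hlap0 y hy]⟩)
    obtain ⟨hyV, hxp⟩ := hNS hy
    have hH0 : 0 ≤ normSqAt G y (hessAt G N y) := normSqAt_nonneg_of_pos hG hyV (hpos y hyV) _
    have hw : c₈ ≤ Real.exp (2 * σ / xf y) * xf y ^ 8 := by
      rw [hc₈]; exact exp_weight_pow_eight_ge hσ.le hxp
    have hlap : lapAt G N y ^ 2 ≤ (finrank ℝ E : ℝ) * normSqAt G y (hessAt G N y) := by
      have := mtrAt_sq_le_normSqAt hG hyV (hpos y hyV) (hessAt G N y)
      simpa [lapAt] using this
    calc lapAt G N y ^ 2 ≤ (finrank ℝ E : ℝ) * normSqAt G y (hessAt G N y) := hlap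
      _ = ((finrank ℝ E : ℝ) / c₈) * (c₈ * normSqAt G y (hessAt G N y)) := by
          rw [← mul_assoc, div_mul_cancel₀ _ hc₈0.ne']
      _ ≤ ((finrank ℝ E : ℝ) / c₈) * (Real.exp (2 * σ / xf y) * xf y ^ 8
            * normSqAt G y (hessAt G N y)) :=
          mul_le_mul_of_nonneg_left (mul_le_mul_of_nonneg_right hw hH0) (by positivity)
      _ = _ := by ring
  -- nonnegativity
  have hNn0 : 0 ≤ Nn := by
    rw [hNn]
    exact integral_nonneg fun y ↦ mul_nonneg (Real.sqrt_nonneg _) (sq_nonneg _)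
  have hYy0 : 0 ≤ Yy := by
    rw [hYy]
    refine integral_nonneg fun y ↦ mul_nonneg (Real.sqrt_nonneg _) ?_
    by_cases hy : y ∈ tsupport Y
    · have hyV := (hYS hy).1
      by_cases hz : Y y = 0
      · simp [hz]
      · exact (hpos y hyV _ hz).le
    · rw [image_eq_zero_of_notMem_tsupport hy]; simp
  have hR0 : 0 ≤ R := by
    rw [hR]
    refine add_nonneg (integral_nonneg fun y ↦ mul_nonneg (Real.sqrt_nonneg _) ?_)
      (integral_nonneg fun y ↦ mul_nonneg (Real.sqrt_nonneg _) ?_)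
    · by_cases hy : y ∈ tsupport N ∪ tsupport Y
      · have hyV : y ∈ V := by
          rcases hy with h | h
          · exact (hNS h).1
          · exact (hYS h).1
        have := normSqAt_nonneg_of_pos hG hyV (hpos y hyV) (adjHamK G K N y + adjMomKS G Y y)
        positivity
      · obtain ⟨hNz, hYz⟩ := eventuallyEq_zero_of_notMem_union hy
        rw [(kidRows_eq_zero_of_eventuallyEq (G := G) (K := K) hNz hYz).1, hn00]; simp
    · by_cases hy : y ∈ tsupport N ∪ tsupport Y
      · have hyV : y ∈ V := by
          rcases hy with h | h
          · exact (hNS h).1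
          · exact (hYS h).1
        have := normSqAt_nonneg_of_pos hG hyV (hpos y hyV) (adjHamG G K N y + adjMomGS G K Y y)
        positivity
      · obtain ⟨hNz, hYz⟩ := eventuallyEq_zero_of_notMem_union hy
        rw [(kidRows_eq_zero_of_eventuallyEq (G := G) (K := K) hNz hYz).2.1, hn00]; simp
  have hwH0 : 0 ≤ wH := by
    rw [hwH]
    refine integral_nonneg fun y ↦ mul_nonneg (Real.sqrt_nonneg _) ?_
    by_cases hy : y ∈ tsupport N
    · have hyV := (hNS hy).1
      have := normSqAt_nonneg_of_pos hG hyV (hpos y hyV) (hessAt G N y)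
      positivity
    · rw [hhess0 y hy, hn00]; simp
  have hDg0 : 0 ≤ Dg := by
    rw [hDg]
    refine integral_nonneg fun y ↦ mul_nonneg (Real.sqrt_nonneg _) ?_
    by_cases hy : y ∈ tsupport N
    · exact hG.gradSqAt_nonneg (hNS hy).1 (hpos y (hNS hy).1) _
    · rw [gradSqAt_eq_zero_of_eventuallyEq_const (notMem_tsupport_iff_eventuallyEq.mp hy)]
  have hWl0 : 0 ≤ Wl := by
    rw [hWl]
    refine add_nonneg (add_nonneg (add_nonneg ?_ ?_) ?_) ?_
    · refine integral_nonneg fun y ↦ mul_nonneg (Real.sqrt_nonneg _) ?_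
      by_cases hy : y ∈ tsupport Y
      · have hyV := (hYS hy).1
        have : 0 ≤ G y (Y y) (Y y) := by
          by_cases hz : Y y = 0
          · simp [hz]
          · exact (hpos y hyV _ hz).le
        positivity
      · rw [image_eq_zero_of_notMem_tsupport hy]; simp
    · refine integral_nonneg fun y ↦ mul_nonneg (Real.sqrt_nonneg _) ?_
      by_cases hy : y ∈ tsupport Y
      · have hyV := (hYS hy).1
        have := hG.mtrAt_bilinearComp_nonneg hyV (hpos y hyV) (covDAt G Y y)
        have hx4 : 0 ≤ xf y ^ 4 := pow_nonneg (hYS hy).2.le 4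
        positivity
      · have hYz : Y =ᶠ[𝓝 y] fun _ ↦ 0 := notMem_tsupport_iff_eventuallyEq.mp hy
        rw [covDAt_eq_zero_of_eventuallyEq hYz, mtrAt_eq_sum b]; simp
    · exact integral_nonneg fun y ↦ mul_nonneg (Real.sqrt_nonneg _) (by positivity)
    · refine integral_nonneg fun y ↦ mul_nonneg (Real.sqrt_nonneg _) ?_
      by_cases hy : y ∈ tsupport N
      · have := hG.gradSqAt_nonneg (hNS hy).1 (hpos y (hNS hy).1) N
        have hx4 : 0 ≤ xf y ^ 4 := pow_nonneg (hNS hy).2.le 4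
        positivity
      · rw [gradSqAt_eq_zero_of_eventuallyEq_const (notMem_tsupport_iff_eventuallyEq.mp hy)]
        simp
  -- the absorption
  have j1 : Wl + wH ≤ A' * (R + Nn + Yy + Dg) :=
    i1.trans (mul_le_mul_of_nonneg_right (le_max_left _ _) (by positivity))
  have j2 : A' * Dg ≤ A' * (lam / 2) * Nn + 4⁻¹ * wH := by
    have a := mul_le_mul_of_nonneg_left i2 hA'0
    have c : (2 * lam)⁻¹ * L ≤ (2 * lam)⁻¹ * (((finrank ℝ E : ℝ) / c₈) * wH) :=
      mul_le_mul_of_nonneg_left (by linarith [i3]) (by positivity)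
    have c' := mul_le_mul_of_nonneg_left c hA'0
    have d : A' * ((2 * lam)⁻¹ * (((finrank ℝ E : ℝ) / c₈) * wH)) ≤ 4⁻¹ * wH := by
      rw [show A' * ((2 * lam)⁻¹ * (((finrank ℝ E : ℝ) / c₈) * wH))
        = (A' * ((2 * lam)⁻¹ * ((finrank ℝ E : ℝ) / c₈))) * wH by ring]
      exact mul_le_mul_of_nonneg_right hkey hwH0
    have e : A' * (lam / 2 * Nn + (2 * lam)⁻¹ * L)
        = A' * (lam / 2) * Nn + A' * ((2 * lam)⁻¹ * L) := by ring
    rw [e] at a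
    linarith
  have e1 : A' * (R + Nn + Yy + Dg) = A' * R + A' * Nn + A' * Yy + A' * Dg := by ring
  rw [e1] at j1
  have hRN : 0 ≤ A' * R := mul_nonneg hA'0 hR0
  have hYN : 0 ≤ A' * Yy := mul_nonneg hA'0 hYy0
  have hNN : 0 ≤ A' * Nn := mul_nonneg hA'0 hNn0
  have hlN : 0 ≤ A' * lam * Nn := by positivity
  have hlR : 0 ≤ A' * lam * R := by positivity
  have hlY : 0 ≤ A' * lam * Yy := by positivity
  have e2 : 4 * A' * (1 + lam) * (R + Nn + Yy) = 4 * (A' * R) + 4 * (A' * lam * R)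
      + 4 * (A' * Nn) + 4 * (A' * lam * Nn) + 4 * (A' * Yy) + 4 * (A' * lam * Yy) := by ring
  have e3 : A' * (lam / 2) * Nn = 2⁻¹ * (A' * lam * Nn) := by ring
  rw [e3] at j2
  rw [e2]
  linarith

end MetricCoord

end Literature.Geometry.Lorentzian

end
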